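import Literature.IUT.LogVolume.ExplicitEstimatesSzpiroConductorFormRadicalBoundProofs
import Literature.NumberTheory.DiophantineGeometry.ConductorMultiplicativeProofs
import Literature.NumberTheory.DiophantineGeometry.ConductorAdditiveProofs
import Literature.NumberTheory.EllipticCurves.MultiplicativeReductionJValuationProofs
import Literature.NumberTheory.DiophantineGeometry.MinimalDiscriminantSmulProofs
import Literature.NumberTheory.DiophantineGeometry.MinimalDiscriminantNormProofs
import Literature.NumberTheory.DiophantineGeometry.MinimalDiscriminantProofs
import Literature.NumberTheory.DiophantineGeometry.LocalReductionIsIntegralAtProofs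
import Literature.NumberTheory.EllipticCurves.LegendreFormValuation
import Literature.IUT.LogVolume.ArakelovDivisors
import HarnessLib

/-!
# [ExpEst] Remark 5.3.3, the local comparison (R1) PLACE BY PLACE — PROVED at every finite place `v` of every
# number field: `ord_v(𝔇_{E_λ}) + 6·[v ∈ I_L(λ,1−λ,−1)] ≤ (−ord_v j(λ))⁺ + 6·f_v(E_λ) + 12·ord_v(2)`

S. Mochizuki, I. Fesenko, Y. Hoshi, A. Minamide, W. Porowski, *Explicit estimates in inter-universal
Teichmüller theory*, Kodai Math. J. **45** (2022) 175–236 — [ExpEst], bib key `MochizukiEtAl2022` (claim key,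
status disputed) — **Remark 5.3.3**, p. 222 l. 18–37: "`E_λ` has semi-stable reduction at every place `v … such
that `λ` is integral at `v`, and `v` does not divide `2`. If … `λ` is not integral at `v`, then … there exists `u ∈
L^×` such that `u = λw²` … a unit or a uniformizer at `v`. Thus `E_λ` is defined by the equation `(y′)² = x′(x′−u)
(x′−uλ′)` … In particular, by applying a similar argument to … [Silv1], Chapter VII, §5, the proof of Proposition
5.4, we obtain that (R1) `log N(𝔇_{E_λ}) ≤ d·h_non(j(E_λ)) + 6(log N(𝔣_{E_λ}) − log rad_L(λ,1−λ,−1)) + d·(8 − (−4))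
log 2`." (R1) is typed upstream VERBATIM as the hypothesis predicate `ExpEst.Rmk533LocalBound`. This PROOF-ONLY
file proves its PLACE-BY-PLACE content — the printed `w`-scaling argument at every finite place INCLUDING the
places above `2` (their budget is the printed `d·(8 − (−4))·log 2 = Σ_{v∣2} 12·e_v·log N(v)`); a sequel sums the
local inequalities into (R1). No definition, no named fact, no instance. TAKES NO SIDE on [IUTchIII] Cor. 3.12
or on any author; classical (Silverman AEC VII); typed ≠ proved ≠ endorsed; no abc / Szpiro claim.

Notation: `E_λ = ⟨0, −(1+λ), 0, λ, 0⟩`, `λ ≠ 0, 1`; `ord_v = Literature.IUT.LogVolume.ord L v`; `𝔇 = ord_v(Δ_min)` =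
`ordMinimalDiscriminant`; `f_v = conductorExponent` (Ogg); `I_L` = tree `badPrimes λ (1−λ) (−1)` (= Thm 5.3's
`I_L`, `radL_eq_radicalNorm`); `j(λ)` = tree `Cor22.jInv λ` (= `j(E_λ)`, `legendre_j_eq_jInv`); `t = ord_v 2`.
PROVED: §1 **`ord_v(Δ_min) ≤ ord_v Δ(W)` for every `v`-integral equation `W`** (the defining minimality, AEC
VII.1; Mathlib `IsMinimal` via the tree's `valuation_Δ_aux_smul_le_of_isMinimal`); §2 ultrametric bookkeeping
for `λ`; §3 **`ord_v(𝔇) ≤ (−ord_v j)⁺ + 6 + 12t`** at every place, from the integral equations `E_λ` (`|λ|_v ≤ 1`: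
even `≤ (−ord_v j)⁺ + 12t`) and `w⁻¹ • E_λ`, `w = π_v^m`, `2m ∈ {k, k+1}`, `k = −ord_v λ > 0` (the printed `u =
λw²`: `ord_v Δ = 12m − 4k + 4t`, `−ord_v j = 2k − 8t`); §4 **`rmk533_local`**, by the local trichotomy: good
(`𝔇 = 0`; a place of `I_L` away from `2` is never good, `…RadicalBoundProofs` §1; at `v ∣ 2`, `6 ≤ 12t`),
multiplicative (`𝔇 = −ord_v j`, AEC VII.5.1 (b) = tree `log_valuation_j_eq_ordMinimalDiscriminant_of_…`; `f = 1`),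
additive (`f ≥ 2`, ATAEC IV.10.2 (c) = tree `two_le_conductorExponent_iff_holds`; §3). The constants are
attained (odd additive places: `𝔇 = (−ord j) + 6`, `f = 2`, `v ∈ I_L`), so the printed `6(…)` is sharp locally.
-/
noncomputable section

open scoped Classical
open NumberField IsDedekindDomain WeierstrassCurve
open Literature.NumberTheory.DiophantineGeometry Literature.NumberTheory.EllipticCurves

namespace Literature.IUT.LogVolume

namespace ExpEst

/-! ## 1. `ord_v(Δ_min) ≤ ord_v(Δ(W))` for every `v`-integral equation `W` -/

section Minimality

variable {A : Type*} [CommRing A] [IsDedekindDomain A] {K : Type*} [Field K] [Algebra A K]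
  [IsFractionRing A K]

/-- **The defining minimality of `𝔇_min`** (Silverman AEC VII.1, Definition p. 186: "minimal … `ord_v(Δ)`
minimized subject to `aᵢ ∈ R`"): for a `v`-INTEGRAL Weierstrass equation `W` of an elliptic curve,
`|Δ(W)|_v ≤ |π_v|^{ord_v(Δ_min)}`, i.e. `ord_v(Δ(W)) ≥ ord_v(Δ_min)`. Proof: `W_{K_v} = E⁻¹ • M` for the chosen
minimal model `M`, Mathlib's `IsMinimal` (`valuation_Δ_aux_smul_le_of_isMinimal`), the equivalence of the two
valuations of `K_v`, and `addVal ↔ Valued.v` on `O_v` (`exists_addVal_adicCompletionIntegers_eq`).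
[cite: SilvermanAEC2009, VII.1 Definition p. 186] -/
theorem valuation_Δ_le_exp_neg_ordMinimalDiscriminant (v : HeightOneSpectrum A) (W : WeierstrassCurve K)
    [W.IsElliptic] (hW : W.IsIntegralAt v) :
    v.valuation K W.Δ ≤ WithZero.exp (-(W.ordMinimalDiscriminant v : ℤ)) := by
  set Ov := v.adicCompletionIntegers K
  set Kv := v.adicCompletion K
  set X := W.baseChange Kv with hX
  haveI hXi : X.IsIntegral Ov := hW
  obtain ⟨E, hE⟩ : ∃ E : VariableChange Kv, W.localMinimalModel v = E • X := ⟨_, rfl⟩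
  set M := W.localMinimalModel v with hM
  have hXE : E⁻¹ • M = X := by rw [hE, smul_smul, inv_mul_cancel, one_smul]
  haveI : (E⁻¹ • M).IsIntegral Ov := by rw [hXE]; exact hXi
  have hle := valuation_Δ_aux_smul_le_of_isMinimal Ov M E⁻¹
  have hle' : (valuation_Δ_aux Ov (E⁻¹ • M)).1 ≤ (valuation_Δ_aux Ov M).1 := hle
  rw [valuation_Δ_aux_eq_of_isIntegral, valuation_Δ_aux_eq_of_isIntegral, hXE] at hle'
  have hle'' : Valued.v X.Δ ≤ Valued.v M.Δ :=
    ((isEquiv_valuation_maximalIdeal_valued v) X.Δ M.Δ).mp hle'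
  have hXΔ : Valued.v X.Δ = v.valuation K W.Δ := by
    rw [hX, WeierstrassCurve.baseChange, map_Δ]; exact valued_algebraMap_adicCompletion v W.Δ
  have hMΔ : algebraMap Ov Kv (W.localMinimalIntegralModel v).Δ = M.Δ := integralModel_Δ_eq Ov _
  have hΔ0 : (W.localMinimalIntegralModel v).Δ ≠ 0 := localMinimalIntegralModel_Δ_ne_zero v W
  obtain ⟨n, hn, hvn⟩ := HeightOneSpectrum.exists_addVal_adicCompletionIntegers_eq K v _ hΔ0
  have hord : W.ordMinimalDiscriminant v = n := by
    rw [ordMinimalDiscriminant, hn]; rfl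
  rw [← hXΔ, hord]
  rw [← hMΔ] at hle''
  exact hle''.trans (le_of_eq hvn)

end Minimality

variable {L : Type*} [Field L] [NumberField L]

/-- `|x|_v = exp(−ord_v x)` for `x ≠ 0` (the tree's `ord` of `ArakelovDivisors`). [folklore] -/
private theorem valuation_eq_exp_neg_ord (v : HeightOneSpectrum (𝓞 L)) {x : L} (hx : x ≠ 0) :
    v.valuation L x = WithZero.exp (-(ord L v x)) := by
  rw [ord, neg_neg, WithZero.exp_log ((Valuation.ne_zero_iff _).mpr hx)]

/-- `ord_v x ≤ ord_v y ⟺ |y|_v ≤ |x|_v` (`x, y ≠ 0`). [folklore] -/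
private theorem ord_le_ord_iff (v : HeightOneSpectrum (𝓞 L)) {x y : L} (hx : x ≠ 0) (hy : y ≠ 0) :
    ord L v x ≤ ord L v y ↔ v.valuation L y ≤ v.valuation L x := by
  rw [valuation_eq_exp_neg_ord v hx, valuation_eq_exp_neg_ord v hy, WithZero.exp_le_exp, neg_le_neg_iff]

/-- `0 ≤ ord_v x ⟺ |x|_v ≤ 1` (`x ≠ 0`). [folklore] -/
private theorem ord_nonneg_iff (v : HeightOneSpectrum (𝓞 L)) {x : L} (hx : x ≠ 0) :
    0 ≤ ord L v x ↔ v.valuation L x ≤ 1 := by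
  rw [valuation_eq_exp_neg_ord v hx, ← WithZero.exp_zero, WithZero.exp_le_exp, neg_nonpos]

/-- `ord_v x = 0 ⟺ |x|_v = 1` (`x ≠ 0`). [folklore] -/
private theorem ord_eq_zero_iff (v : HeightOneSpectrum (𝓞 L)) {x : L} (hx : x ≠ 0) :
    ord L v x = 0 ↔ v.valuation L x = 1 := by
  rw [valuation_eq_exp_neg_ord v hx, ← WithZero.exp_zero, WithZero.exp_inj, neg_eq_zero]

/-- `0 < ord_v x ⟺ |x|_v < 1` (`x ≠ 0`). [folklore] -/
private theorem ord_pos_iff (v : HeightOneSpectrum (𝓞 L)) {x : L} (hx : x ≠ 0) :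
    0 < ord L v x ↔ v.valuation L x < 1 := by
  rw [valuation_eq_exp_neg_ord v hx, ← WithZero.exp_zero, WithZero.exp_lt_exp, neg_lt_zero]

/-- The order of the minimal discriminant is bounded by the order of the discriminant of ANY `v`-integral
equation (§1 in `ord` form, number-field case). [cite: SilvermanAEC2009, VII.1 Definition p. 186] -/
theorem ordMinimalDiscriminant_le_ord_Δ_of_isIntegralAt (v : HeightOneSpectrum (𝓞 L)) (W : WeierstrassCurve L)
    [W.IsElliptic] (hW : W.IsIntegralAt v) : (W.ordMinimalDiscriminant v : ℤ) ≤ ord L v W.Δ := by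
  have h := valuation_Δ_le_exp_neg_ordMinimalDiscriminant v W hW
  rw [valuation_eq_exp_neg_ord v W.isUnit_Δ.ne_zero, WithZero.exp_le_exp, neg_le_neg_iff] at h
  exact h

/-! ## 2. Ultrametric bookkeeping for `λ` -/

/-- `ord_v 2 ≥ 0`. [folklore] -/
private theorem ord_two_nonneg (v : HeightOneSpectrum (𝓞 L)) : 0 ≤ ord L v (2 : L) := by
  rw [← map_ofNat (algebraMap (𝓞 L) L) 2]; exact ord_nonneg_of_isIntegral L v 2

/-- `ord_v 2 = 0 ⟺ |2|_v = 1`. [folklore] -/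
private theorem ord_two_eq_zero_iff (v : HeightOneSpectrum (𝓞 L)) :
    ord L v (2 : L) = 0 ↔ v.valuation L (2 : L) = 1 := ord_eq_zero_iff v two_ne_zero

/-- `ord_v (2^n) = n·ord_v 2`. [folklore] -/
private theorem ord_two_pow (v : HeightOneSpectrum (𝓞 L)) (n : ℕ) : ord L v ((2 : L) ^ n) = n * ord L v (2 : L) :=
  ord_pow L v 2 n

/-- Regime `|λ|_v < 1`: `|λ − 1|_v = |λ² − λ + 1|_v = 1`. [folklore] -/
private theorem val_aux_of_lt_one (v : HeightOneSpectrum (𝓞 L)) {lam : L}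
    (hlt : v.valuation L lam < 1) :
    v.valuation L (lam - 1) = 1 ∧ v.valuation L (lam ^ 2 - lam + 1) = 1 := by
  have h1 : v.valuation L (lam - 1) = 1 := by
    rw [Valuation.map_sub_swap]; exact Valuation.map_one_sub_of_lt _ hlt
  refine ⟨h1, ?_⟩
  have hlt' : v.valuation L (lam ^ 2 - lam) < 1 := by
    rw [show lam ^ 2 - lam = lam * (lam - 1) by ring, Valuation.map_mul, h1, mul_one]; exact hlt
  rw [show lam ^ 2 - lam + 1 = 1 + (lam ^ 2 - lam) by ring]
  exact Valuation.map_one_add_of_lt _ hlt'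

/-- Regime `|λ − 1|_v < 1`: `|λ|_v = |λ² − λ + 1|_v = 1`. [folklore] -/
private theorem val_aux_of_sub_one_lt_one (v : HeightOneSpectrum (𝓞 L)) {lam : L}
    (hlt : v.valuation L (lam - 1) < 1) :
    v.valuation L lam = 1 ∧ v.valuation L (lam ^ 2 - lam + 1) = 1 := by
  have hl : v.valuation L lam = 1 := by
    rw [show lam = 1 + (lam - 1) by ring]; exact Valuation.map_one_add_of_lt _ hlt
  refine ⟨hl, ?_⟩
  have hlt' : v.valuation L ((lam - 1) ^ 2 + (lam - 1)) < 1 := by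
    rw [show (lam - 1) ^ 2 + (lam - 1) = (lam - 1) * lam by ring, Valuation.map_mul, hl, mul_one]; exact hlt
  rw [show lam ^ 2 - lam + 1 = 1 + ((lam - 1) ^ 2 + (lam - 1)) by ring]
  exact Valuation.map_one_add_of_lt _ hlt'

/-- Regime `|λ|_v > 1` in `ord` form: `ord_v(λ − 1) = ord_v(1 + λ) = ord_v λ`, `ord_v(λ² − λ + 1) = 2·ord_v λ`
(all three elements are non-zero). [folklore] -/
private theorem ord_aux_of_ord_neg (v : HeightOneSpectrum (𝓞 L)) {lam : L} (h0 : lam ≠ 0)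
    (h : ord L v lam < 0) :
    (lam - 1 ≠ 0 ∧ ord L v (lam - 1) = ord L v lam) ∧ (1 + lam ≠ 0 ∧ ord L v (1 + lam) = ord L v lam) ∧
      (lam ^ 2 - lam + 1 ≠ 0 ∧ ord L v (lam ^ 2 - lam + 1) = 2 * ord L v lam) := by
  have hv0 : v.valuation L lam ≠ 0 := (Valuation.ne_zero_iff _).mpr h0
  have hval : v.valuation L lam = WithZero.exp (-(ord L v lam)) := valuation_eq_exp_neg_ord v h0
  have hgt : v.valuation L (1 : L) < v.valuation L lam := by
    rw [Valuation.map_one, hval, ← WithZero.exp_zero, WithZero.exp_lt_exp]; linarith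
  have hs : v.valuation L (lam - 1) = v.valuation L lam := Valuation.map_sub_eq_of_lt_left _ hgt
  have ha : v.valuation L (1 + lam) = v.valuation L lam := Valuation.map_add_eq_of_lt_right _ hgt
  have hsq : v.valuation L (lam ^ 2) = WithZero.exp (-(2 * ord L v lam)) := by
    rw [Valuation.map_pow, hval, sq, ← WithZero.exp_add]; congr 1; ring
  have hq : v.valuation L (lam ^ 2 - lam + 1) = WithZero.exp (-(2 * ord L v lam)) := by
    have hlt' : v.valuation L (1 - lam) < v.valuation L (lam ^ 2) := by
      rw [Valuation.map_sub_swap, hs, hsq, hval, WithZero.exp_lt_exp]; linarith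
    rw [show lam ^ 2 - lam + 1 = lam ^ 2 + (1 - lam) by ring, Valuation.map_add_eq_of_lt_left _ hlt', hsq]
  have hne1 : lam - 1 ≠ 0 := fun h' => hv0 (by rw [← hs, h', Valuation.map_zero])
  have hne2 : 1 + lam ≠ 0 := fun h' => hv0 (by rw [← ha, h', Valuation.map_zero])
  have hne3 : lam ^ 2 - lam + 1 ≠ 0 := fun h' => by
    rw [h', Valuation.map_zero] at hq; exact WithZero.exp_ne_zero hq.symm
  refine ⟨⟨hne1, by rw [ord, ord, hs]⟩, ⟨hne2, by rw [ord, ord, ha]⟩, ⟨hne3, ?_⟩⟩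
  rw [ord, hq, WithZero.log_exp, neg_neg]

/-! ## 3. `ord_v(𝔇_{E_λ}) ≤ (−ord_v j(λ))⁺ + 6 + 12·ord_v(2)` from the two integral equations -/

/-- `ord_v Δ(E_λ) = 4·ord_v 2 + 2·ord_v λ + 2·ord_v(λ − 1)` (`Δ = 16λ²(λ−1)²`, tree `legendre_Δ`).
[cite: SilvermanAEC2009, Prop. III.1.7 (proof)] -/
theorem ord_Δ_legendre (v : HeightOneSpectrum (𝓞 L)) {lam : L} (h0 : lam ≠ 0) (h1 : lam ≠ 1) :
    ord L v (⟨0, -(1 + lam), 0, lam, 0⟩ : WeierstrassCurve L).Δ =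
      4 * ord L v (2 : L) + 2 * ord L v lam + 2 * ord L v (lam - 1) := by
  have h16 : (16 : L) ≠ 0 := by norm_num
  have hl1 : lam - 1 ≠ 0 := sub_ne_zero.mpr h1
  rw [legendre_Δ, ord_mul L v (mul_ne_zero h16 (pow_ne_zero 2 h0)) (pow_ne_zero 2 hl1),
    ord_mul L v h16 (pow_ne_zero 2 h0), ord_pow, ord_pow, show (16 : L) = 2 ^ 4 by norm_num, ord_two_pow]
  push_cast; ring

/-- `−ord_v j(λ) = 2·ord_v λ + 2·ord_v(λ−1) − 8·ord_v 2 − 3·ord_v(λ² − λ + 1)` for the `j`-invariant `jInv λ =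
2⁸(λ²−λ+1)³/(λ²(λ−1)²)` of `E_λ` (tree `Cor22.jInv`), when `λ² − λ + 1 ≠ 0`. [cite: SilvermanAEC2009, Prop. III.1.7(b)] -/
theorem neg_ord_jInv (v : HeightOneSpectrum (𝓞 L)) {lam : L} (h0 : lam ≠ 0) (h1 : lam ≠ 1)
    (hq : lam ^ 2 - lam + 1 ≠ 0) :
    -ord L v (Cor22.jInv lam) =
      2 * ord L v lam + 2 * ord L v (lam - 1) - 8 * ord L v (2 : L) - 3 * ord L v (lam ^ 2 - lam + 1) := by
  have hl1 : lam - 1 ≠ 0 := sub_ne_zero.mpr h1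
  have h28 : (2 : L) ^ 8 ≠ 0 := pow_ne_zero 8 two_ne_zero
  rw [Cor22.jInv, div_eq_mul_inv, ord_mul L v (mul_ne_zero h28 (pow_ne_zero 3 hq))
    (inv_ne_zero (mul_ne_zero (pow_ne_zero 2 h0) (pow_ne_zero 2 hl1))), ord_mul L v h28 (pow_ne_zero 3 hq),
    ord_inv, ord_mul L v (pow_ne_zero 2 h0) (pow_ne_zero 2 hl1)]
  simp only [ord_pow]
  push_cast; ring

/-- **Case `|λ|_v ≤ 1` of the printed argument** ("`E_λ` has semi-stable reduction at every place … such that `λ`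
is integral at `v` …" — only the integrality is used here, at ALL `v`): the Legendre equation itself is
`v`-integral, so `ord_v(𝔇) ≤ ord_v Δ(E_λ) = 4t + 2·ord λ + 2·ord(λ−1) ≤ (−ord_v j(λ))⁺ + 12t`, `t = ord_v 2` (when `λ
≡ 0` or `1 (mod v)`, `λ² − λ + 1` is a `v`-unit and `−ord_v j = 2·ord λ + 2·ord(λ−1) − 8t`; otherwise `ord Δ =
4t`). [cite: MochizukiEtAl2022, Rmk 5.3.3 p. 222 l. 18–21] -/
theorem ordMinimalDiscriminant_le_of_ord_nonneg (v : HeightOneSpectrum (𝓞 L)) {lam : L} (h0 : lam ≠ 0)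
    (h1 : lam ≠ 1) (hint : 0 ≤ ord L v lam) :
    ((⟨0, -(1 + lam), 0, lam, 0⟩ : WeierstrassCurve L).ordMinimalDiscriminant v : ℤ) ≤
      max 0 (-ord L v (Cor22.jInv lam)) + 12 * ord L v (2 : L) := by
  haveI := isElliptic_legendre_of_ne h0 h1
  have hl1 : lam - 1 ≠ 0 := sub_ne_zero.mpr h1
  have hle : v.valuation L lam ≤ 1 := (ord_nonneg_iff v h0).mp hint
  have hD := ordMinimalDiscriminant_le_ord_Δ_of_isIntegralAt v _
    (legendre_isIntegralAt_of_valuation_le_one v hle)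
  rw [ord_Δ_legendre v h0 h1] at hD
  have ht := ord_two_nonneg v
  have hJ := le_max_left 0 (-ord L v (Cor22.jInv lam))
  have hb : 0 ≤ ord L v (lam - 1) :=
    (ord_nonneg_iff v hl1).mpr (Valuation.map_sub_le _ hle (by rw [Valuation.map_one]))
  rcases hint.lt_or_eq with hpos | hzero
  · -- `λ ≡ 0`: `λ − 1`, `λ² − λ + 1` units
    obtain ⟨hv1, hvq⟩ := val_aux_of_lt_one v ((ord_pos_iff v h0).mp hpos)
    have hq0 : lam ^ 2 - lam + 1 ≠ 0 := fun h' => by rw [h', Valuation.map_zero] at hvq; exact zero_ne_one hvq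
    have hb0 : ord L v (lam - 1) = 0 := (ord_eq_zero_iff v hl1).mpr hv1
    have hq0' : ord L v (lam ^ 2 - lam + 1) = 0 := (ord_eq_zero_iff v hq0).mpr hvq
    have hj := neg_ord_jInv v h0 h1 hq0
    rw [hb0, hq0'] at hj
    have hJ' : 2 * ord L v lam + 2 * 0 - 8 * ord L v (2 : L) - 3 * 0 ≤ max 0 (-ord L v (Cor22.jInv lam)) :=
      le_max_of_le_right hj.symm.le
    rw [hb0] at hD
    by_cases hcase : 8 * ord L v (2 : L) ≤ 2 * ord L v lam <;> linarith
  · rcases hb.lt_or_eq with hbpos | hbzero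
    · -- `λ ≡ 1`: `λ`, `λ² − λ + 1` units
      obtain ⟨hv0, hvq⟩ := val_aux_of_sub_one_lt_one v ((ord_pos_iff v hl1).mp hbpos)
      have hq0 : lam ^ 2 - lam + 1 ≠ 0 := fun h' => by rw [h', Valuation.map_zero] at hvq; exact zero_ne_one hvq
      have hq0' : ord L v (lam ^ 2 - lam + 1) = 0 := (ord_eq_zero_iff v hq0).mpr hvq
      have hj := neg_ord_jInv v h0 h1 hq0
      rw [← hzero, hq0'] at hj
      have hJ' : 2 * 0 + 2 * ord L v (lam - 1) - 8 * ord L v (2 : L) - 3 * 0 ≤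
          max 0 (-ord L v (Cor22.jInv lam)) := le_max_of_le_right hj.symm.le
      rw [← hzero] at hD
      by_cases hcase : 8 * ord L v (2 : L) ≤ 2 * ord L v (lam - 1) <;> linarith
    · -- `λ, λ − 1` units: `ord Δ = 4t ≤ 12t`
      rw [← hzero, ← hbzero] at hD
      linarith

omit [NumberField L] in
/-- The scaled equation of the printed argument for `λ` NOT integral at `v`: with `w ∈ L^×`, the change of
variables `u = w⁻¹` (`x = w⁻²x′`, `y = w⁻³y′`) carries `E_λ` to `⟨0, −w²(1+λ), 0, w⁴λ, 0⟩`, i.e. `y′² = x′(x′ −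
w²)(x′ − w²λ)` — the printed `(y′)² = x′(x′−u)(x′−uλ′)` with `u = λw²`, `λ′ = λ⁻¹`. Silverman AEC III.1 (change
of variables). [cite: MochizukiEtAl2022, Rmk 5.3.3 p. 222 l. 21–26] -/
theorem smul_legendre_eq_scaled {lam w : L} (hw : w ≠ 0) :
    (⟨(Units.mk0 w hw)⁻¹, 0, 0, 0⟩ : VariableChange L) • (⟨0, -(1 + lam), 0, lam, 0⟩ : WeierstrassCurve L) =
      ⟨0, -(w ^ 2 * (1 + lam)), 0, w ^ 4 * lam, 0⟩ := by
  ext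
  · simp [variableChange_a₁]
  · simp only [variableChange_a₂, inv_inv, Units.val_mk0]; ring
  · simp [variableChange_a₃]
  · simp only [variableChange_a₄, inv_inv, Units.val_mk0]; ring
  · simp [variableChange_a₆]

/-- **Case `|λ|_v > 1` of the printed argument** ("there exists … `u = λw²` … a unit or a uniformizer at `v` …
`(y′)² = x′(x′−u)(x′−uλ′)` … [so `u` and `uλ′` are integral at `v`]"): with `k = −ord_v λ > 0`, `w = π_v^m`, `2m ∈
{k, k+1}`, the scaled equation is `v`-integral, `ord_v` of its discriminant is `12m − 4k + 4t ≤ 2k + 6 + 4t`, and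
`−ord_v j(λ) = 2k − 8t`; hence `ord_v(𝔇) ≤ (−ord_v j(λ))⁺ + 6 + 12t` (`t = ord_v 2`).
[cite: MochizukiEtAl2022, Rmk 5.3.3 p. 222 l. 21–37] -/
theorem ordMinimalDiscriminant_le_of_ord_neg (v : HeightOneSpectrum (𝓞 L)) {lam : L} (h0 : lam ≠ 0)
    (h1 : lam ≠ 1) (hneg : ord L v lam < 0) :
    ((⟨0, -(1 + lam), 0, lam, 0⟩ : WeierstrassCurve L).ordMinimalDiscriminant v : ℤ) ≤
      max 0 (-ord L v (Cor22.jInv lam)) + 6 + 12 * ord L v (2 : L) := by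
  haveI := isElliptic_legendre_of_ne h0 h1
  obtain ⟨⟨hl1, hordl1⟩, ⟨h1l, hord1l⟩, ⟨hq, hordq⟩⟩ := ord_aux_of_ord_neg v h0 hneg
  -- a uniformizer `π` and the scaling `w = π^m`, `2m ∈ {k, k+1}`, `k = −ord λ`
  obtain ⟨ϖ, hϖ⟩ := exists_ord_eq_one L v
  have hϖ0 : ϖ ≠ 0 := fun h => by rw [h, ord_zero] at hϖ; exact zero_ne_one hϖ
  set k : ℕ := (-ord L v lam).toNat with hk
  have hkZ : (k : ℤ) = -ord L v lam := by rw [hk]; exact Int.toNat_of_nonneg (by linarith)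
  set m : ℕ := (k + 1) / 2 with hm
  have hm1N : k ≤ 2 * m := by
    have h := Nat.div_add_mod (k + 1) 2; have hr := Nat.mod_lt (k + 1) (show 0 < 2 by norm_num); omega
  have hm2N : 2 * m ≤ k + 1 := by have h := Nat.div_add_mod (k + 1) 2; omega
  have hm1 : (k : ℤ) ≤ 2 * (m : ℤ) := by exact_mod_cast hm1N
  have hm2 : 2 * (m : ℤ) ≤ (k : ℤ) + 1 := by exact_mod_cast hm2N
  set w : L := ϖ ^ m with hwdef
  have hw : w ≠ 0 := pow_ne_zero m hϖ0
  have hordw : ord L v w = m := by rw [hwdef, ord_pow, hϖ, mul_one]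
  set C : VariableChange L := ⟨(Units.mk0 w hw)⁻¹, 0, 0, 0⟩ with hC
  have hM : C • (⟨0, -(1 + lam), 0, lam, 0⟩ : WeierstrassCurve L) = ⟨0, -(w ^ 2 * (1 + lam)), 0, w ^ 4 * lam, 0⟩ :=
    smul_legendre_eq_scaled hw
  haveI hMell : (C • (⟨0, -(1 + lam), 0, lam, 0⟩ : WeierstrassCurve L)).IsElliptic := inferInstance
  -- the scaled equation is `v`-integral
  have hint : (C • (⟨0, -(1 + lam), 0, lam, 0⟩ : WeierstrassCurve L)).IsIntegralAt v := by
    rw [hM]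
    refine isIntegralAt_of_valuation_le_one v _ (by simp) ?_ (by simp) ?_ (by simp)
    · show v.valuation L (-(w ^ 2 * (1 + lam))) ≤ 1
      rw [Valuation.map_neg, ← ord_nonneg_iff v (mul_ne_zero (pow_ne_zero 2 hw) h1l),
        ord_mul L v (pow_ne_zero 2 hw) h1l, ord_pow, hordw, hord1l]
      push_cast; linarith
    · show v.valuation L (w ^ 4 * lam) ≤ 1
      rw [← ord_nonneg_iff v (mul_ne_zero (pow_ne_zero 4 hw) h0), ord_mul L v (pow_ne_zero 4 hw) h0, ord_pow,
        hordw]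
      push_cast; linarith
  -- `ord 𝔇(E) = ord 𝔇(C • E) ≤ ord Δ(C • E) = 12 m + ord Δ(E)`
  have hD := ordMinimalDiscriminant_le_ord_Δ_of_isIntegralAt v _ hint
  have hu : ord L v ((↑C.u⁻¹ : L)) = m := by simp [hC, hordw]
  rw [ordMinimalDiscriminant_smul_holds v _ C, variableChange_Δ,
    ord_mul L v (pow_ne_zero 12 (by simp [hC, hw])) (WeierstrassCurve.isUnit_Δ _).ne_zero, ord_pow, hu,
    ord_Δ_legendre v h0 h1, hordl1] at hD
  have hj := neg_ord_jInv v h0 h1 hq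
  rw [hordl1, hordq] at hj
  have hJ := le_max_left 0 (-ord L v (Cor22.jInv lam))
  have hJ' : 2 * ord L v lam + 2 * ord L v lam - 8 * ord L v (2 : L) - 3 * (2 * ord L v lam) ≤
      max 0 (-ord L v (Cor22.jInv lam)) := le_max_of_le_right hj.symm.le
  have ht := ord_two_nonneg v
  push_cast at hD
  by_cases hcase : 8 * ord L v (2 : L) ≤ 2 * (k : ℤ) <;> nlinarith

/-- **`ord_v(𝔇_{E_λ}) ≤ (−ord_v j(λ))⁺ + 6 + 12·ord_v(2)` at every finite place** (both cases).
[cite: MochizukiEtAl2022, Rmk 5.3.3 p. 222 l. 18–37] -/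
theorem ordMinimalDiscriminant_le_negOrdJ_add (v : HeightOneSpectrum (𝓞 L)) {lam : L} (h0 : lam ≠ 0)
    (h1 : lam ≠ 1) :
    ((⟨0, -(1 + lam), 0, lam, 0⟩ : WeierstrassCurve L).ordMinimalDiscriminant v : ℤ) ≤
      max 0 (-ord L v (Cor22.jInv lam)) + 6 + 12 * ord L v (2 : L) := by
  rcases le_or_gt 0 (ord L v lam) with h | h
  · have := ordMinimalDiscriminant_le_of_ord_nonneg v h0 h1 h; linarith
  · exact ordMinimalDiscriminant_le_of_ord_neg v h0 h1 h

/-! ## 4. The local inequality of (R1) -/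

omit [NumberField L] in
/-- `j(E_λ) = jInv λ` (`2⁸(λ²−λ+1)³/(λ²(λ−1)²)`, Silverman AEC III.1.7 (b); the tree's `Cor22.jInv`).
[cite: SilvermanAEC2009, Prop. III.1.7(b)] -/
theorem legendre_j_eq_jInv {lam : L} (h0 : lam ≠ 0) (h1 : lam ≠ 1)
    [hE : (⟨0, -(1 + lam), 0, lam, 0⟩ : WeierstrassCurve L).IsElliptic] :
    (⟨0, -(1 + lam), 0, lam, 0⟩ : WeierstrassCurve L).j = Cor22.jInv lam := by
  have hl1 : lam - 1 ≠ 0 := sub_ne_zero.mpr h1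
  rw [WeierstrassCurve.j, Units.val_inv_eq_inv_val, WeierstrassCurve.coe_Δ', legendre_c₄, legendre_Δ, Cor22.jInv]
  field_simp
  ring

/-- **The local inequality behind (R1), PROVED at every finite place `v` of every number field**: for `λ ≠ 0,
1`, `ord_v(𝔇_{E_λ}) + 6·[v ∈ I_L(λ, 1−λ, −1)] ≤ (−ord_v j(λ))⁺ + 6·f_v(E_λ) + 12·ord_v(2)`. By the local trichotomy
(Silverman AEC VII.5.1): good reduction — `ord_v 𝔇 = 0`, and `v ∈ I_L` forces `v ∣ 2` (`…RadicalBoundProofs`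
§1), where `6 ≤ 12·ord_v 2`; multiplicative — `ord_v 𝔇 = −ord_v j` (AEC VII.5.1 (b), tree
`log_valuation_j_eq_ordMinimalDiscriminant_of_hasMultiplicativeReductionAt`) and `f_v = 1` (ATAEC IV.10.2 (b));
additive — `f_v ≥ 2` (ATAEC IV.10.2 (c), tree `two_le_conductorExponent_iff_holds`) and §3. Summing `v ↦ (·)·log
N(v)` gives (R1) (sequel file). [cite: MochizukiEtAl2022, Rmk 5.3.3 p. 222 l. 34–37] -/
theorem rmk533_local (v : HeightOneSpectrum (𝓞 L)) {lam : L} (h0 : lam ≠ 0) (h1 : lam ≠ 1) :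
    ((⟨0, -(1 + lam), 0, lam, 0⟩ : WeierstrassCurve L).ordMinimalDiscriminant v : ℤ) +
        6 * (if v ∈ badPrimes lam (1 - lam) (-1) then 1 else 0) ≤
      max 0 (-ord L v (Cor22.jInv lam)) +
        6 * ((⟨0, -(1 + lam), 0, lam, 0⟩ : WeierstrassCurve L).conductorExponent v : ℤ) +
          12 * ord L v (2 : L) := by
  haveI := isElliptic_legendre_of_ne h0 h1
  set E : WeierstrassCurve L := ⟨0, -(1 + lam), 0, lam, 0⟩ with hE
  have ht := ord_two_nonneg v
  have hJ := le_max_left 0 (-ord L v (Cor22.jInv lam))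
  have hχ : (if v ∈ badPrimes lam (1 - lam) (-1) then (1 : ℤ) else 0) ≤ 1 := by split_ifs <;> norm_num
  have hf0 : (0 : ℤ) ≤ (E.conductorExponent v : ℤ) := Nat.cast_nonneg _
  rcases hasGoodReductionAt_or_hasMultiplicativeReductionAt_or_hasAdditiveReductionAt v E with hg | hm | ha
  · -- good reduction
    have hD : E.ordMinimalDiscriminant v = 0 := (ordMinimalDiscriminant_eq_zero_iff_holds v E).mpr hg
    rw [hD, Nat.cast_zero, zero_add]
    by_cases h2 : ord L v (2 : L) = 0
    · -- `v ∤ 2`: a place in `I_L` is not a place of good reduction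
      have hnot : v ∉ badPrimes lam (1 - lam) (-1) := fun hv =>
        (legendre_mem_badPrimes_iff_not_hasGoodReductionAt v h0 h1 ((ord_two_eq_zero_iff v).mp h2)).mp hv hg
      rw [if_neg hnot]; linarith
    · have h2' : 1 ≤ ord L v (2 : L) := by omega
      linarith
  · -- multiplicative reduction: `ord 𝔇 = −ord j`, `f = 1`
    have hlog := log_valuation_j_eq_ordMinimalDiscriminant_of_hasMultiplicativeReductionAt v E hm
    have hj : E.j = Cor22.jInv lam := legendre_j_eq_jInv h0 h1
    have hDj : (E.ordMinimalDiscriminant v : ℤ) = -ord L v (Cor22.jInv lam) := by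
      rw [← hlog, ord, neg_neg, hj]
    have hf : E.conductorExponent v = 1 := (conductorExponent_eq_one_iff_holds v E).mpr hm
    have hJ' := le_max_right 0 (-ord L v (Cor22.jInv lam))
    rw [hf, Nat.cast_one]
    linarith
  · -- additive reduction: `f ≥ 2` and §3
    have hf : (2 : ℤ) ≤ (E.conductorExponent v : ℤ) := by
      exact_mod_cast (two_le_conductorExponent_iff_holds v E).mpr ha
    have hH := ordMinimalDiscriminant_le_negOrdJ_add v h0 h1
    linarith

end ExpEst

end Literature.IUT.LogVolume
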